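import Literature.NumberTheory.ComplexMultiplication.FaltingsTateOfDistinctCMFields
import Literature.AlgebraicGeometry.Motives.FaltingsTateBiprodAdditivity
import HarnessLib

/-!
# [Faltings 1983, §5 Kor. 1] for products of powers of two CM elliptic structures

Theorems only (topic `NumberTheory/ComplexMultiplication`; no definition, no named fact, no instance).
Assembly of `FaltingsTateOfCMEllipticPowers` (pairs of powers of ONE structure),
`FaltingsTateOfDistinctCMFields` (powers of two structures with non-isomorphic CM fields) and the
additivity of the statement in both arguments (`Motives/FaltingsTateBiprodAdditivity`,
`faltings_tate_bijective_biprod_biprod`).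

For CM elliptic structures `(A₁, ι₁)` of type `(K₁, Φ₁)` and `(A₂, ι₂)` of type `(K₂, Φ₂)` over the
same field `k` (`k → ℂ`; the predicate quantifies over `[NumberField k]`) with `[K_i : ℚ] = 2` and
`K₁ ≄ K₂`, **`faltings_tate_bijective A B ℓ` holds for every `A` `k`-isogenous to `A₁ᵃ ⊞ A₂ᵇ`, every
`B` `k`-isogenous to `A₁ᶜ ⊞ A₂ᵈ` and every prime `ℓ`**
(`faltings_tate_bijective_of_isIsogenous_prod_of_distinct_CM_elliptic_of_thm18_6`, granted
[Shimura 1998, Thm. 18.6]; discharged Summits-side) — the four corners `(A₁ᵃ, A₁ᶜ)`, `(A₂ᵇ, A₂ᵈ)`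
(one structure) and `(A₁ᵃ, A₂ᵈ)`, `(A₂ᵇ, A₁ᶜ)` (two fields, both Tate sides vanish), then additivity and
isogeny invariance.  Stated for TWO CM fields; a `Fin n`-indexed family of pairwise non-isomorphic CM
fields follows by the same induction over `faltings_tate_bijective_biprod_biprod` but needs dependent
families of number fields and is not spelled here.

## References

* [Faltings1983Endlichkeit] G. Faltings, Invent. Math. 73 (1983), §5 Korollar 1 (the statement decided).
* [Shimura1998] G. Shimura, *Abelian Varieties with Complex Multiplication and Modular Functions*
  (1998), §13.1 Theorem 1; §18.6 Theorem 18.6.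
-/

noncomputable section

open CategoryTheory CategoryTheory.Limits
open scoped NumberField

namespace Literature.NumberTheory.ComplexMultiplication

open Literature.AlgebraicGeometry.Motives Literature.AlgebraicGeometry.Motives.AbelianVariety

/-- **[Fal83 §5 Kor. 1] for `(A₁ᵃ ⊞ A₂ᵇ, A₁ᶜ ⊞ A₂ᵈ)` and their isogeny classes**, two CM elliptic
structures with non-isomorphic CM fields, granted [Shimura 1998, Thm. 18.6]: the four corners by
`faltings_tate_bijective_pow_pow_of_CM_elliptic_of_thm18_6` (same structure) and
`faltings_tate_bijective_of_isIsogenous_pow_of_distinct_CM_elliptic_of_thm18_6` (two fields), then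
`faltings_tate_bijective_biprod_biprod` and `faltings_tate_bijective_of_isIsogenous`.
[cite: Faltings1983Endlichkeit, §5 Korollar 1] [cite: Shimura1998, §13.1 Theorem 1 (ii) and §18.6 Theorem 18.6] -/
theorem faltings_tate_bijective_of_isIsogenous_prod_of_distinct_CM_elliptic_of_thm18_6
    (h186 : shimura1998_thm18_6) :
    ∀ {k : Type} [Field k] [Algebra k ℂ] {K₁ K₂ : Type} [Field K₁] [NumberField K₁]
      [NumberField.IsCMField K₁] [Field K₂] [NumberField K₂] [NumberField.IsCMField K₂]
      (Φ₁ : CMType K₁) (A₁ : AbelianVariety k) (ι₁ : 𝓞 K₁ →+* End A₁)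
      (Φ₂ : CMType K₂) (A₂ : AbelianVariety k) (ι₂ : 𝓞 K₂ →+* End A₂),
      IsCMTypeRealisationOver Φ₁ A₁ ι₁ → Module.finrank ℚ K₁ = 2 →
      IsCMTypeRealisationOver Φ₂ A₂ ι₂ → Module.finrank ℚ K₂ = 2 → IsEmpty (K₁ ≃ₐ[ℚ] K₂) →
      ∀ (a b c d : ℕ) (A B : AbelianVariety k),
        IsIsogenous ((⨁ fun _ : Fin a => A₁) ⊞ (⨁ fun _ : Fin b => A₂)) A →
        IsIsogenous ((⨁ fun _ : Fin c => A₁) ⊞ (⨁ fun _ : Fin d => A₂)) B →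
        ∀ (ℓ : ℕ) [Fact ℓ.Prime], faltings_tate_bijective A B ℓ := by
  intro k _ _ K₁ K₂ _ _ _ _ _ _ Φ₁ A₁ ι₁ Φ₂ A₂ ι₂ hA₁ h2₁ hA₂ h2₂ hK a b c d A B hA hB ℓ _
  have hK' : IsEmpty (K₂ ≃ₐ[ℚ] K₁) := ⟨fun e => hK.false e.symm⟩
  -- the four corners
  have h₁₁ : faltings_tate_bijective (⨁ fun _ : Fin a => A₁) (⨁ fun _ : Fin c => A₁) ℓ := fun {_} =>
    faltings_tate_bijective_pow_pow_of_CM_elliptic_of_thm18_6 h186 Φ₁ A₁ ι₁ hA₁ h2₁ a c ℓ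
  have h₂₂ : faltings_tate_bijective (⨁ fun _ : Fin b => A₂) (⨁ fun _ : Fin d => A₂) ℓ := fun {_} =>
    faltings_tate_bijective_pow_pow_of_CM_elliptic_of_thm18_6 h186 Φ₂ A₂ ι₂ hA₂ h2₂ b d ℓ
  have h₁₂ : faltings_tate_bijective (⨁ fun _ : Fin a => A₁) (⨁ fun _ : Fin d => A₂) ℓ := fun {_} =>
    faltings_tate_bijective_of_isIsogenous_pow_of_distinct_CM_elliptic_of_thm18_6 h186 Φ₁ A₁ ι₁ Φ₂ A₂ ι₂
      hA₁ h2₁ hA₂ h2₂ hK a d _ _ (IsIsogenous.refl _) (IsIsogenous.refl _) ℓ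
  have h₂₁ : faltings_tate_bijective (⨁ fun _ : Fin b => A₂) (⨁ fun _ : Fin c => A₁) ℓ := fun {_} =>
    faltings_tate_bijective_of_isIsogenous_pow_of_distinct_CM_elliptic_of_thm18_6 h186 Φ₂ A₂ ι₂ Φ₁ A₁ ι₁
      hA₂ h2₂ hA₁ h2₁ hK' b c _ _ (IsIsogenous.refl _) (IsIsogenous.refl _) ℓ
  intro hk
  exact faltings_tate_bijective_of_isIsogenous ℓ hA hB
    (faltings_tate_bijective_biprod_biprod ℓ _ _ _ _ h₁₁ h₁₂ h₂₁ h₂₂)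

end Literature.NumberTheory.ComplexMultiplication

end
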